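import Mathlib.Algebra.Lie.Basic
import Mathlib.RingTheory.Nilpotent.Exp
import Mathlib.Algebra.Module.Submodule.Basic
import Mathlib.Data.Real.Basic
import Mathlib.Algebra.Algebra.Rat
import Mathlib.Algebra.BigOperators.NatAntidiagonal
import Mathlib.Logic.Function.Iterate
import HarnessLib

/-!
# Truncated formal Lie series: `L[ε]/(ε^{n+1})` and the canonical transformations `e^{ε^p ad u}`

`Literature/Algebra/Lie/` — the algebra behind the "formal change of variable"
`e^{εL_U} = ∑_k ε^k L_U^k / k!` of KAM-type perturbation theory, in the form used by
W. De Roeck, F. Huveneers, CPAM 68 (2015), arXiv:1305.5127, §3.3 ("The operators `Q` and `R` are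
formal canonical transformations, inverse of each other. Therefore `L_H R = R L_{QH}`"), for an
arbitrary real Lie algebra `L` (there: smooth functions with the Poisson bracket).

## Contents (all proved; no named facts)

* `TruncSeries L n` — truncated formal power series `F = ∑_{k ≤ n} ε^k F_k` with coefficients in a
  real Lie algebra `L` (coefficients `F.coeff k`, zero for `k > n`), an `ℝ`-module; its
  MULTIPLICATION `F * G` IS THE TRUNCATED BRACKET `(F * G)_k = ∑_{i+j=k} ⁅F_i, G_j⁆` (`k ≤ n`),
  making it a (non-unital, non-associative) `ℚ`-algebra.
* `shiftAd p u` — the derivation `ε^p ad_u`: `(ε^p ad_u F)_k = ⁅u, F_{k-p}⁆`; it is a derivation of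
  `*` (Jacobi in `L`) and nilpotent for `p ≥ 1` (`shiftAd_pow_eq_zero`).
* `expOp p u = e^{ε^p ad_u}` (Mathlib's `IsNilpotent.exp`), with: the coefficient formula
  `expOp_coeff` (`(e^{ε^p ad_u} F)_k = ∑_{j : jp ≤ k} (ad_u)^j F_{k-jp} / j!`), in particular
  `expOp_coeff_of_lt` and `expOp_coeff_self`; **multiplicativity**
  `expOp_mul : e^{D}(F * G) = e^{D} F * e^{D} G` (Mathlib's `Module.End.exp_mul_of_derivation`) and
  **inversion** `expOp_expOp_neg`, `expOp_neg_expOp` (`e^{ε^p ad_u} e^{ε^p ad_{-u}} = id`);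
* `qOp u m = e^{ε^m ad u_m} ∘ ⋯ ∘ e^{ε ad u_1}` and `rOp u m = e^{-ε ad u_1} ∘ ⋯ ∘ e^{-ε^m ad u_m}`
  (the paper's `Q`, `R` truncated at order `n`): mutually inverse, multiplicative
  (`rOp_mul`, `qOp_rOp`, `rOp_qOp`), hence the **intertwining identity**
  `mul_rOp : H * rOp u m F = rOp u m (qOp u m H * F)` ("`L_H R = R L_{QH}`" at the truncated level);
* `eval ε F = ∑_{k ≤ n} ε^k F_k ∈ L` and the truncation remainder `lie_eval_eval_of_coeff_eq_zero`:
  if `H_k = 0` for `2 ≤ k` then `⁅eval ε H, eval ε F⁆ = eval ε (H * F) + ε^{n+1} ⁅H_1, F_n⁆`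
  (the term `ε^{n₁+1} L_V (Rf)^{(n₁)}` of Proposition 1 (2) of the paper).

## Design notes

* `TruncSeries L n` is a `def` (not reducible) wrapping the submodule of `ℕ → L` of sequences
  vanishing beyond `n`; only the instances declared here apply to it. Its `ℚ`-module structure is
  the restriction of the `ℝ`-structure (`ratCast_smul_eq`), as needed by `IsNilpotent.exp`.
* The bracket is registered as `Mul` because Mathlib's exponential-of-a-derivation lemma is stated
  for `NonUnitalNonAssocRing`s; no associativity or Jacobi identity is claimed for `*`.
-/

noncomputable section

open Finset Function

namespace Literature.Algebra.Lie

universe u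

variable (L : Type u) [LieRing L] [LieAlgebra ℝ L]

/-- Sequences `ℕ → L` vanishing beyond `n` (coefficients of truncated series). [folklore] -/
def truncSubmodule (n : ℕ) : Submodule ℝ (ℕ → L) where
  carrier := {f | ∀ k, n < k → f k = 0}
  add_mem' := by
    intro f g hf hg k hk
    simp [hf k hk, hg k hk]
  zero_mem' := by intro k _; rfl
  smul_mem' := by
    intro c f hf k hk
    simp [hf k hk]

/-- **Truncated formal Lie series** `L[ε]/(ε^{n+1})`: `F = ∑_{k ≤ n} ε^k F_k`, `F_k ∈ L`.
[cite: DeRoeckHuveneers2015, §3.1 eq. (3.5) (truncation `𝒯_l`) and §3.3] -/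
def TruncSeries (n : ℕ) : Type u := ↥(truncSubmodule L n)

namespace TruncSeries

variable {L} {n : ℕ}

/-- Additive group structure (coefficientwise). [folklore] -/
instance instAddCommGroup : AddCommGroup (TruncSeries L n) :=
  inferInstanceAs (AddCommGroup ↥(truncSubmodule L n))

/-- Real vector space structure (coefficientwise). [folklore] -/
instance instModule : Module ℝ (TruncSeries L n) :=
  inferInstanceAs (Module ℝ ↥(truncSubmodule L n))

/-- The `ℚ`-module structure: restriction of the real scalars. [folklore] -/
instance instModuleRat : Module ℚ (TruncSeries L n) := Module.compHom (TruncSeries L n) (algebraMap ℚ ℝ)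

/-- The `k`-th coefficient `F_k` (zero for `k > n`). [folklore] -/
def coeff (F : TruncSeries L n) (k : ℕ) : L := (show ↥(truncSubmodule L n) from F).1 k

/-- Build a truncated series from a sequence vanishing beyond `n`. [folklore] -/
def mk (f : ℕ → L) (hf : ∀ k, n < k → f k = 0) : TruncSeries L n :=
  (⟨f, hf⟩ : ↥(truncSubmodule L n))

/-- Coefficients of `mk`. [folklore] -/
@[simp] theorem coeff_mk (f : ℕ → L) (hf : ∀ k, n < k → f k = 0) (k : ℕ) : (mk f hf).coeff k = f k := rfl

/-- Coefficients beyond the truncation order vanish. [folklore] -/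
theorem coeff_eq_zero (F : TruncSeries L n) {k : ℕ} (hk : n < k) : F.coeff k = 0 :=
  (show ↥(truncSubmodule L n) from F).2 k hk

/-- Two truncated series with the same coefficients are equal. [folklore] -/
@[ext] theorem ext {F G : TruncSeries L n} (h : ∀ k, F.coeff k = G.coeff k) : F = G :=
  Subtype.ext (funext h)

/-- Coefficients of a sum. [folklore] -/
@[simp] theorem coeff_add (F G : TruncSeries L n) (k : ℕ) : (F + G).coeff k = F.coeff k + G.coeff k := rfl

/-- Coefficients of zero. [folklore] -/
@[simp] theorem coeff_zero (k : ℕ) : (0 : TruncSeries L n).coeff k = 0 := rfl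

/-- Coefficients of a negative. [folklore] -/
@[simp] theorem coeff_neg (F : TruncSeries L n) (k : ℕ) : (-F).coeff k = -F.coeff k := rfl

/-- Coefficients of a difference. [folklore] -/
@[simp] theorem coeff_sub (F G : TruncSeries L n) (k : ℕ) : (F - G).coeff k = F.coeff k - G.coeff k := rfl

/-- Coefficients of a real multiple. [folklore] -/
@[simp] theorem coeff_smul (c : ℝ) (F : TruncSeries L n) (k : ℕ) : (c • F).coeff k = c • F.coeff k := rfl

/-- Rational scalars act through the reals. [folklore] -/
theorem ratCast_smul_eq (q : ℚ) (F : TruncSeries L n) : q • F = (q : ℝ) • F := rfl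

/-- Coefficients of a rational multiple. [folklore] -/
@[simp] theorem coeff_rat_smul (q : ℚ) (F : TruncSeries L n) (k : ℕ) : (q • F).coeff k = (q : ℝ) • F.coeff k := rfl

/-! ### The truncated bracket, registered as multiplication -/

/-- The truncated bracket `(F * G)_k = ∑_{i+j=k} ⁅F_i, G_j⁆` for `k ≤ n` (and `0` beyond).
[cite: DeRoeckHuveneers2015, §3.3 (formal series, truncation `𝒯_{n₁}`)] -/
instance instMul : Mul (TruncSeries L n) :=
  ⟨fun F G => mk (fun k => if k ≤ n then ∑ p ∈ antidiagonal k, ⁅F.coeff p.1, G.coeff p.2⁆ else 0)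
    (fun _ hk => if_neg (not_le.2 hk))⟩

/-- Coefficients of the truncated bracket. [folklore] -/
theorem coeff_mul (F G : TruncSeries L n) (k : ℕ) :
    (F * G).coeff k = if k ≤ n then ∑ p ∈ antidiagonal k, ⁅F.coeff p.1, G.coeff p.2⁆ else 0 := rfl

/-- Coefficients of the truncated bracket below the truncation order. [folklore] -/
theorem coeff_mul_of_le (F G : TruncSeries L n) {k : ℕ} (hk : k ≤ n) :
    (F * G).coeff k = ∑ p ∈ antidiagonal k, ⁅F.coeff p.1, G.coeff p.2⁆ := by
  rw [coeff_mul, if_pos hk]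

/-- `TruncSeries L n` with the truncated bracket is a non-unital non-associative ring (i.e. the
bracket is biadditive). [folklore] -/
instance instNonUnitalNonAssocRing : NonUnitalNonAssocRing (TruncSeries L n) :=
  { TruncSeries.instAddCommGroup with
    mul := (· * ·)
    left_distrib := fun F G H => by
      ext k
      simp only [coeff_mul, coeff_add]
      split_ifs
      · rw [← sum_add_distrib]
        exact sum_congr rfl fun p _ => lie_add _ _ _
      · simp
    right_distrib := fun F G H => by
      ext k
      simp only [coeff_mul, coeff_add]
      split_ifs
      · rw [← sum_add_distrib]
        exact sum_congr rfl fun p _ => add_lie _ _ _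
      · simp
    zero_mul := fun F => by
      ext k
      simp only [coeff_mul, coeff_zero, zero_lie, sum_const_zero, ite_self]
    mul_zero := fun F => by
      ext k
      simp only [coeff_mul, coeff_zero, lie_zero, sum_const_zero, ite_self] }

/-- Real scalars pull out of the bracket on the right. [folklore] -/
theorem mul_smul_real (c : ℝ) (F G : TruncSeries L n) : F * (c • G) = c • (F * G) := by
  ext k
  simp only [coeff_mul, coeff_smul]
  split_ifs
  · rw [smul_sum]
    exact sum_congr rfl fun p _ => lie_smul _ _ _
  · simp

/-- Real scalars pull out of the bracket on the left. [folklore] -/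
theorem smul_mul_real (c : ℝ) (F G : TruncSeries L n) : (c • F) * G = c • (F * G) := by
  ext k
  simp only [coeff_mul, coeff_smul]
  split_ifs
  · rw [smul_sum]
    exact sum_congr rfl fun p _ => smul_lie _ _ _
  · simp

/-- Rational scalars commute with the bracket (right argument). [folklore] -/
instance instSMulCommClassRat : SMulCommClass ℚ (TruncSeries L n) (TruncSeries L n) :=
  ⟨fun q F G => by
    change (q : ℝ) • (F * G) = F * ((q : ℝ) • G)
    exact (mul_smul_real _ _ _).symm⟩

/-- Rational scalars commute with the bracket (left argument). [folklore] -/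
instance instIsScalarTowerRat : IsScalarTower ℚ (TruncSeries L n) (TruncSeries L n) :=
  ⟨fun q F G => by
    change ((q : ℝ) • F) * G = (q : ℝ) • (F * G)
    exact smul_mul_real _ _ _⟩

/-- The truncated bracket is alternating: `F * F = 0`. [folklore] -/
theorem mul_self_eq_zero (F : TruncSeries L n) : F * F = 0 := by
  ext k
  simp only [coeff_mul, coeff_zero]
  split_ifs
  · -- pair `(i, j)` with `(j, i)`
    have h := Finset.Nat.sum_antidiagonal_swap (n := k) (f := fun p => ⁅F.coeff p.1, F.coeff p.2⁆)
    -- `∑ ⁅F_j, F_i⁆ = ∑ ⁅F_i, F_j⁆`, and the left side is `-` the right side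
    have h2 : ∑ p ∈ antidiagonal k, ⁅F.coeff p.2, F.coeff p.1⁆ =
        -∑ p ∈ antidiagonal k, ⁅F.coeff p.1, F.coeff p.2⁆ := by
      rw [← sum_neg_distrib]
      exact sum_congr rfl fun p _ => (lie_skew _ _).symm
    simp only [Prod.fst_swap, Prod.snd_swap] at h
    rw [h] at h2
    -- `x = -x` in an additive group of a real vector space
    have h3 : (2 : ℝ) • ∑ p ∈ antidiagonal k, ⁅F.coeff p.1, F.coeff p.2⁆ = 0 := by
      rw [two_smul]
      nth_rewrite 2 [h2]
      exact add_neg_cancel _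
    exact (smul_eq_zero.1 h3).resolve_left two_ne_zero
  · rfl

/-- Antisymmetry of the truncated bracket. [folklore] -/
theorem mul_antisymm (F G : TruncSeries L n) : F * G = -(G * F) := by
  have h := mul_self_eq_zero (F + G)
  rw [add_mul, mul_add, mul_add, mul_self_eq_zero, mul_self_eq_zero, zero_add, add_zero] at h
  exact eq_neg_of_add_eq_zero_left h

/-! ### The derivations `ε^p ad_u` -/

/-- The derivation `ε^p ad_u` of `L[ε]/(ε^{n+1})`: `(ε^p ad_u F)_k = ⁅u, F_{k-p}⁆` for `p ≤ k ≤ n`.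
[cite: DeRoeckHuveneers2015, §3.3 ("`e^{ε^k L_{U^{(k)}}}`")] -/
def shiftAd (p : ℕ) (u : L) : TruncSeries L n →ₗ[ℚ] TruncSeries L n where
  toFun F := mk (fun k => if p ≤ k ∧ k ≤ n then ⁅u, F.coeff (k - p)⁆ else 0)
    (fun k hk => if_neg fun h => absurd h.2 (not_le.2 hk))
  map_add' F G := by
    ext k
    simp only [coeff_mk, coeff_add]
    split_ifs
    · exact lie_add _ _ _
    · simp
  map_smul' q F := by
    ext k
    simp only [coeff_mk, coeff_rat_smul, RingHom.id_apply]
    split_ifs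
    · exact lie_smul _ _ _
    · simp

/-- Coefficients of `ε^p ad_u F`. [folklore] -/
theorem shiftAd_coeff (p : ℕ) (u : L) (F : TruncSeries L n) (k : ℕ) :
    (shiftAd p u F).coeff k = if p ≤ k ∧ k ≤ n then ⁅u, F.coeff (k - p)⁆ else 0 := rfl

/-- `ε^p ad_{-u} = -ε^p ad_u`. [folklore] -/
theorem shiftAd_neg (p : ℕ) (u : L) : (shiftAd p (-u) : TruncSeries L n →ₗ[ℚ] TruncSeries L n) = -shiftAd p u := by
  ext F k
  simp only [shiftAd_coeff, LinearMap.neg_apply, coeff_neg]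
  split_ifs
  · exact neg_lie _ _
  · simp

/-- Shifting an antidiagonal sum: `∑_{i'+j=k, p ≤ i'} f(i'-p, j) = ∑_{i+j=k-p} f(i, j)` (`p ≤ k`).
[folklore] -/
theorem sum_antidiagonal_shift_fst {M : Type*} [AddCommMonoid M] (f : ℕ × ℕ → M) {p k : ℕ} (hpk : p ≤ k) :
    ∑ q ∈ antidiagonal k, (if p ≤ q.1 then f (q.1 - p, q.2) else 0) =
      ∑ q ∈ antidiagonal (k - p), f q := by
  rw [← sum_filter]
  refine sum_nbij' (fun q => (q.1 - p, q.2)) (fun q => (q.1 + p, q.2)) ?_ ?_ ?_ ?_ ?_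
  · intro q hq
    simp only [mem_filter, mem_antidiagonal] at hq
    simp only [mem_antidiagonal]
    omega
  · intro q hq
    simp only [mem_antidiagonal] at hq
    simp only [mem_filter, mem_antidiagonal]
    omega
  · intro q hq
    simp only [mem_filter, mem_antidiagonal] at hq
    ext
    · simp only; omega
    · rfl
  · intro q hq
    ext <;> simp
  · intro q hq
    rfl

/-- Shifting an antidiagonal sum in the second variable. [folklore] -/
theorem sum_antidiagonal_shift_snd {M : Type*} [AddCommMonoid M] (f : ℕ × ℕ → M) {p k : ℕ} (hpk : p ≤ k) :
    ∑ q ∈ antidiagonal k, (if p ≤ q.2 then f (q.1, q.2 - p) else 0) =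
      ∑ q ∈ antidiagonal (k - p), f q := by
  rw [← sum_filter]
  refine sum_nbij' (fun q => (q.1, q.2 - p)) (fun q => (q.1, q.2 + p)) ?_ ?_ ?_ ?_ ?_
  · intro q hq
    simp only [mem_filter, mem_antidiagonal] at hq
    simp only [mem_antidiagonal]
    omega
  · intro q hq
    simp only [mem_antidiagonal] at hq
    simp only [mem_filter, mem_antidiagonal]
    omega
  · intro q hq
    simp only [mem_filter, mem_antidiagonal] at hq
    ext
    · rfl
    · simp only; omega
  · intro q hq
    ext <;> simp
  · intro q hq
    rfl

/-- **`ε^p ad_u` is a derivation of the truncated bracket** (the Jacobi identity of `L`).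
[cite: DeRoeckHuveneers2015, §3.3] -/
theorem shiftAd_mul (p : ℕ) (u : L) (F G : TruncSeries L n) :
    shiftAd p u (F * G) = F * shiftAd p u G + shiftAd p u F * G := by
  ext k
  simp only [shiftAd_coeff, coeff_add, coeff_mul]
  by_cases hkn : k ≤ n
  · simp only [hkn, and_true, if_true]
    by_cases hpk : p ≤ k
    · rw [if_pos hpk, if_pos (le_trans (Nat.sub_le k p) hkn)]
      -- right side, first sum: `∑_{i+j=k} ⁅F_i, [p ≤ j] ⁅u, G_{j-p}⁆⁆`
      have h1 : ∑ q ∈ antidiagonal k, ⁅F.coeff q.1, (if p ≤ q.2 ∧ q.2 ≤ n then ⁅u, G.coeff (q.2 - p)⁆ else 0)⁆ =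
          ∑ q ∈ antidiagonal (k - p), ⁅F.coeff q.1, ⁅u, G.coeff q.2⁆⁆ := by
        rw [← sum_antidiagonal_shift_snd (fun q => ⁅F.coeff q.1, ⁅u, G.coeff q.2⁆⁆) hpk]
        refine sum_congr rfl fun q hq => ?_
        have hq2 : q.2 ≤ n := le_trans (by rw [mem_antidiagonal] at hq; omega) hkn
        by_cases h : p ≤ q.2
        · rw [if_pos ⟨h, hq2⟩, if_pos h]
        · rw [if_neg (fun h' => h h'.1), if_neg h, lie_zero]
      have h2 : ∑ q ∈ antidiagonal k, ⁅(if p ≤ q.1 ∧ q.1 ≤ n then ⁅u, F.coeff (q.1 - p)⁆ else 0), G.coeff q.2⁆ =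
          ∑ q ∈ antidiagonal (k - p), ⁅⁅u, F.coeff q.1⁆, G.coeff q.2⁆ := by
        rw [← sum_antidiagonal_shift_fst (fun q => ⁅⁅u, F.coeff q.1⁆, G.coeff q.2⁆) hpk]
        refine sum_congr rfl fun q hq => ?_
        have hq1 : q.1 ≤ n := le_trans (by rw [mem_antidiagonal] at hq; omega) hkn
        by_cases h : p ≤ q.1
        · rw [if_pos ⟨h, hq1⟩, if_pos h]
        · rw [if_neg (fun h' => h h'.1), if_neg h, zero_lie]
      rw [h1, h2, ← sum_add_distrib, lie_sum]
      refine sum_congr rfl fun q _ => ?_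
      rw [leibniz_lie, add_comm]
    · rw [if_neg hpk]
      symm
      -- both sums vanish termwise: `i + j = k < p` forces `j < p` and `i < p`
      rw [sum_eq_zero, sum_eq_zero, add_zero]
      · intro q hq
        rw [mem_antidiagonal] at hq
        rw [if_neg (fun h => hpk (le_trans h.1 (by omega))), zero_lie]
      · intro q hq
        rw [mem_antidiagonal] at hq
        rw [if_neg (fun h => hpk (le_trans h.1 (by omega))), lie_zero]
  · simp only [hkn, and_false, if_false]
    simp

/-- Iterates of `ε^p ad_u`: `((ε^p ad_u)^j F)_k = ad_u^j F_{k - jp}` for `jp ≤ k ≤ n`, else `0`.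
[folklore] -/
theorem shiftAd_pow_coeff (p : ℕ) (u : L) (j : ℕ) (F : TruncSeries L n) (k : ℕ) (hk : k ≤ n) :
    ((shiftAd p u ^ j) F).coeff k =
      if j * p ≤ k then (fun x : L => ⁅u, x⁆)^[j] (F.coeff (k - j * p)) else 0 := by
  induction j generalizing k with
  | zero => simp
  | succ j ih =>
    rw [pow_succ', Module.End.mul_apply, shiftAd_coeff]
    by_cases hpk : p ≤ k
    · rw [if_pos ⟨hpk, hk⟩, ih (k - p) (le_trans (Nat.sub_le k p) hk)]
      have e : (j + 1) * p = j * p + p := Nat.succ_mul j p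
      by_cases hj : (j + 1) * p ≤ k
      · have hj' : j * p ≤ k - p := by omega
        rw [if_pos hj', if_pos hj, Function.iterate_succ_apply', e,
          show k - p - j * p = k - (j * p + p) by omega]
      · have hj' : ¬ j * p ≤ k - p := by omega
        rw [if_neg hj', if_neg hj, lie_zero]
    · rw [if_neg (fun h => hpk h.1)]
      have e : (j + 1) * p = j * p + p := Nat.succ_mul j p
      by_cases hj : (j + 1) * p ≤ k
      · exact absurd (le_trans (by omega) hj) hpk
      · rw [if_neg hj]

/-- `ε^p ad_u` is nilpotent on `L[ε]/(ε^{n+1})` for `p ≥ 1`: its `(n+1)`-st power vanishes.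
[folklore] -/
theorem shiftAd_pow_eq_zero {p : ℕ} (hp : 1 ≤ p) (u : L) :
    (shiftAd p u : TruncSeries L n →ₗ[ℚ] TruncSeries L n) ^ (n + 1) = 0 := by
  ext F k
  simp only [LinearMap.zero_apply, coeff_zero]
  by_cases hk : k ≤ n
  · rw [shiftAd_pow_coeff p u (n + 1) F k hk, if_neg]
    intro h
    have : n + 1 ≤ (n + 1) * p := Nat.le_mul_of_pos_right _ hp
    omega
  · exact coeff_eq_zero _ (not_le.1 hk)

/-- `ε^p ad_u` is nilpotent for `p ≥ 1`. [folklore] -/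
theorem isNilpotent_shiftAd {p : ℕ} (hp : 1 ≤ p) (u : L) :
    IsNilpotent (shiftAd p u : TruncSeries L n →ₗ[ℚ] TruncSeries L n) :=
  ⟨n + 1, shiftAd_pow_eq_zero hp u⟩

/-! ### The canonical transformations `e^{ε^p ad_u}` -/

/-- **The formal canonical transformation `e^{ε^p ad_u} = ∑_j (ε^p ad_u)^j / j!`** on
`L[ε]/(ε^{n+1})`. [cite: DeRoeckHuveneers2015, §3.3 ("`e^{εL_U} = ∑_{k≥0} ε^k L_U^k / k!`")] -/
def expOp (p : ℕ) (u : L) (F : TruncSeries L n) : TruncSeries L n :=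
  IsNilpotent.exp (shiftAd p u : TruncSeries L n →ₗ[ℚ] TruncSeries L n) F

/-- `e^{ε^p ad_u}` as the finite sum `∑_{j ≤ n} (ε^p ad_u)^j / j!` (`p ≥ 1`). [folklore] -/
theorem expOp_eq_sum {p : ℕ} (hp : 1 ≤ p) (u : L) (F : TruncSeries L n) :
    expOp p u F = ∑ j ∈ range (n + 1), ((j.factorial : ℝ)⁻¹) • (shiftAd p u ^ j) F := by
  unfold expOp
  rw [IsNilpotent.exp_eq_sum (shiftAd_pow_eq_zero hp u), LinearMap.sum_apply]
  refine sum_congr rfl fun j _ => ?_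
  rw [LinearMap.smul_apply, ratCast_smul_eq, Rat.cast_inv, Rat.cast_natCast]

/-- **Coefficient formula**: `(e^{ε^p ad_u} F)_k = ∑_{j ≤ n, jp ≤ k} ad_u^j F_{k-jp} / j!`
(`p ≥ 1`, `k ≤ n`). [cite: DeRoeckHuveneers2015, §3.3] -/
theorem expOp_coeff {p : ℕ} (hp : 1 ≤ p) (u : L) (F : TruncSeries L n) {k : ℕ} (hk : k ≤ n) :
    (expOp p u F).coeff k = ∑ j ∈ range (n + 1),
      if j * p ≤ k then ((j.factorial : ℝ)⁻¹) • (fun x : L => ⁅u, x⁆)^[j] (F.coeff (k - j * p)) else 0 := by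
  rw [expOp_eq_sum hp]
  have : (∑ j ∈ range (n + 1), ((j.factorial : ℝ)⁻¹) • (shiftAd p u ^ j) F).coeff k =
      ∑ j ∈ range (n + 1), (((j.factorial : ℝ)⁻¹) • (shiftAd p u ^ j) F).coeff k := by
    induction (range (n + 1)) using Finset.induction_on with
    | empty => simp
    | insert a s ha ih => rw [sum_insert ha, sum_insert ha, coeff_add, ih]
  rw [this]
  refine sum_congr rfl fun j _ => ?_
  rw [coeff_smul, shiftAd_pow_coeff p u j F k hk]
  split_ifs
  · rfl
  · rw [smul_zero]

/-- Below order `p`, `e^{ε^p ad_u}` does nothing: `(e^{ε^p ad_u} F)_k = F_k` for `k < p`. [folklore] -/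
theorem expOp_coeff_of_lt {p : ℕ} (hp : 1 ≤ p) (u : L) (F : TruncSeries L n) {k : ℕ} (hk : k < p)
    (hkn : k ≤ n) : (expOp p u F).coeff k = F.coeff k := by
  rw [expOp_coeff hp u F hkn, sum_eq_single_of_mem 0 (by simp)]
  · simp
  · intro j _ hj
    rw [if_neg]
    intro h
    have : p ≤ j * p := Nat.le_mul_of_pos_left p (Nat.pos_of_ne_zero hj)
    omega

/-- At order `p`: `(e^{ε^p ad_u} F)_p = F_p + ⁅u, F_0⁆` (`1 ≤ p ≤ n`). [cite: DeRoeckHuveneers2015, §3.3 ("`Q^{(k)} = S^{(k-1)} + L_{U^{(k)}}`")] -/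
theorem expOp_coeff_self {p : ℕ} (hp : 1 ≤ p) (u : L) (F : TruncSeries L n) (hpn : p ≤ n) :
    (expOp p u F).coeff p = F.coeff p + ⁅u, F.coeff 0⁆ := by
  rw [expOp_coeff hp u F hpn]
  have h01 : ({0, 1} : Finset ℕ) ⊆ range (n + 1) := by
    intro j hj
    simp only [mem_insert, mem_singleton] at hj
    rw [mem_range]; omega
  rw [← sum_subset h01]
  · rw [sum_pair zero_ne_one]
    simp
  · intro j _ hj
    simp only [mem_insert, mem_singleton, not_or] at hj
    rw [if_neg]
    intro h
    have : 2 * p ≤ j * p := Nat.mul_le_mul_right p (by omega)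
    omega

/-- Coefficients beyond the truncation order (for completeness). [folklore] -/
theorem expOp_coeff_of_gt (p : ℕ) (u : L) (F : TruncSeries L n) {k : ℕ} (hk : n < k) :
    (expOp p u F).coeff k = 0 :=
  coeff_eq_zero _ hk

/-- `e^{ε^p ad_u}` is additive. [folklore] -/
theorem expOp_add (p : ℕ) (u : L) (F G : TruncSeries L n) : expOp p u (F + G) = expOp p u F + expOp p u G :=
  map_add _ F G

/-- `e^{ε^p ad_u}` is real-linear. [folklore] -/
theorem expOp_smul {p : ℕ} (hp : 1 ≤ p) (u : L) (c : ℝ) (F : TruncSeries L n) :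
    expOp p u (c • F) = c • expOp p u F := by
  rw [expOp_eq_sum hp, expOp_eq_sum hp, smul_sum]
  refine sum_congr rfl fun j _ => ?_
  have hlin : ∀ (j : ℕ) (G : TruncSeries L n), (shiftAd p u ^ j) (c • G) = c • (shiftAd p u ^ j) G := by
    intro j
    induction j with
    | zero => intro G; simp
    | succ j ih =>
      intro G
      rw [pow_succ', Module.End.mul_apply, Module.End.mul_apply, ih]
      ext k
      simp only [shiftAd_coeff, coeff_smul]
      split_ifs
      · exact lie_smul _ _ _
      · simp
  rw [hlin, smul_comm]

/-- `e^{ε^p ad_u} 0 = 0`. [folklore] -/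
@[simp] theorem expOp_zero (p : ℕ) (u : L) : expOp p u (0 : TruncSeries L n) = 0 := map_zero _

/-- `e^{ε^p ad_u} (-F) = -e^{ε^p ad_u} F`. [folklore] -/
theorem expOp_neg (p : ℕ) (u : L) (F : TruncSeries L n) : expOp p u (-F) = -expOp p u F := map_neg _ F

/-- **`e^{ε^p ad_u}` is multiplicative for the truncated bracket** ("formal canonical
transformation"): `e^{D}(F * G) = e^{D} F * e^{D} G`. [cite: DeRoeckHuveneers2015, §3.3] -/
theorem expOp_mul {p : ℕ} (hp : 1 ≤ p) (u : L) (F G : TruncSeries L n) :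
    expOp p u (F * G) = expOp p u F * expOp p u G :=
  Module.End.exp_mul_of_derivation ℚ (TruncSeries L n) (shiftAd p u)
    (fun x y => shiftAd_mul p u x y) (isNilpotent_shiftAd hp u) F G

/-- **Inversion**: `e^{ε^p ad_u} (e^{ε^p ad_{-u}} F) = F`. [cite: DeRoeckHuveneers2015, §3.3 ("`R` is the formal inverse of `Q`")] -/
theorem expOp_expOp_neg {p : ℕ} (hp : 1 ≤ p) (u : L) (F : TruncSeries L n) :
    expOp p u (expOp p (-u) F) = F := by
  unfold expOp
  rw [shiftAd_neg, ← Module.End.mul_apply, IsNilpotent.exp_mul_exp_neg_self (isNilpotent_shiftAd hp u),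
    Module.End.one_apply]

/-- **Inversion**: `e^{ε^p ad_{-u}} (e^{ε^p ad_u} F) = F`. [cite: DeRoeckHuveneers2015, §3.3] -/
theorem expOp_neg_expOp {p : ℕ} (hp : 1 ≤ p) (u : L) (F : TruncSeries L n) :
    expOp p (-u) (expOp p u F) = F := by
  have := expOp_expOp_neg hp (-u) F
  rwa [neg_neg] at this

/-! ### The composite transformations `Q` and `R` -/

/-- `Q_m = e^{ε^m ad u_m} ∘ ⋯ ∘ e^{ε ad u_1}` ("`Q = ⋯ e^{ε^n L_{U^{(n)}}} ⋯ e^{ε² L_{U^{(2)}}} e^{ε L_{U^{(1)}}}`").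
[cite: DeRoeckHuveneers2015, §3.3] -/
def qOp (u : ℕ → L) : ℕ → TruncSeries L n → TruncSeries L n
  | 0 => id
  | m + 1 => expOp (m + 1) (u (m + 1)) ∘ qOp u m

/-- `R_m = e^{-ε ad u_1} ∘ ⋯ ∘ e^{-ε^m ad u_m}` ("`R = e^{-εL_{U^{(1)}}} e^{-ε²L_{U^{(2)}}} ⋯`", the formal
inverse of `Q`). [cite: DeRoeckHuveneers2015, §3.3] -/
def rOp (u : ℕ → L) : ℕ → TruncSeries L n → TruncSeries L n
  | 0 => id
  | m + 1 => rOp u m ∘ expOp (m + 1) (-u (m + 1))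

/-- `Q_0 = id`. [folklore] -/
@[simp] theorem qOp_zero (u : ℕ → L) (F : TruncSeries L n) : qOp u 0 F = F := rfl
/-- `R_0 = id`. [folklore] -/
@[simp] theorem rOp_zero (u : ℕ → L) (F : TruncSeries L n) : rOp u 0 F = F := rfl

/-- `Q_{m+1} = e^{ε^{m+1} ad u_{m+1}} ∘ Q_m`. [cite: DeRoeckHuveneers2015, §3.3] -/
theorem qOp_succ (u : ℕ → L) (m : ℕ) (F : TruncSeries L n) :
    qOp u (m + 1) F = expOp (m + 1) (u (m + 1)) (qOp u m F) := rfl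

/-- `R_{m+1} = R_m ∘ e^{-ε^{m+1} ad u_{m+1}}`. [cite: DeRoeckHuveneers2015, §3.3] -/
theorem rOp_succ (u : ℕ → L) (m : ℕ) (F : TruncSeries L n) :
    rOp u (m + 1) F = rOp u m (expOp (m + 1) (-u (m + 1)) F) := rfl

/-- `R_m (Q_m F) = F`. [cite: DeRoeckHuveneers2015, §3.3] -/
theorem rOp_qOp (u : ℕ → L) (m : ℕ) (F : TruncSeries L n) : rOp u m (qOp u m F) = F := by
  induction m generalizing F with
  | zero => rfl
  | succ m ih => rw [qOp_succ, rOp_succ, expOp_neg_expOp (Nat.succ_pos m), ih]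

/-- `Q_m (R_m F) = F`. [cite: DeRoeckHuveneers2015, §3.3] -/
theorem qOp_rOp (u : ℕ → L) (m : ℕ) (F : TruncSeries L n) : qOp u m (rOp u m F) = F := by
  induction m generalizing F with
  | zero => rfl
  | succ m ih => rw [rOp_succ, qOp_succ, ih, expOp_expOp_neg (Nat.succ_pos m)]

/-- `Q_m` is multiplicative. [cite: DeRoeckHuveneers2015, §3.3] -/
theorem qOp_mul (u : ℕ → L) (m : ℕ) (F G : TruncSeries L n) : qOp u m (F * G) = qOp u m F * qOp u m G := by
  induction m generalizing F G with
  | zero => rfl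
  | succ m ih => rw [qOp_succ, qOp_succ, qOp_succ, ih, expOp_mul (Nat.succ_pos m)]

/-- `R_m` is multiplicative. [cite: DeRoeckHuveneers2015, §3.3] -/
theorem rOp_mul (u : ℕ → L) (m : ℕ) (F G : TruncSeries L n) : rOp u m (F * G) = rOp u m F * rOp u m G := by
  induction m generalizing F G with
  | zero => rfl
  | succ m ih => rw [rOp_succ, rOp_succ, rOp_succ, expOp_mul (Nat.succ_pos m), ih]

/-- `Q_m` is additive. [folklore] -/
theorem qOp_add (u : ℕ → L) (m : ℕ) (F G : TruncSeries L n) : qOp u m (F + G) = qOp u m F + qOp u m G := by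
  induction m generalizing F G with
  | zero => rfl
  | succ m ih => rw [qOp_succ, qOp_succ, qOp_succ, ih, expOp_add]

/-- `R_m` is additive. [folklore] -/
theorem rOp_add (u : ℕ → L) (m : ℕ) (F G : TruncSeries L n) : rOp u m (F + G) = rOp u m F + rOp u m G := by
  induction m generalizing F G with
  | zero => rfl
  | succ m ih => rw [rOp_succ, rOp_succ, rOp_succ, expOp_add, ih]

/-- `R_m` is real-linear. [folklore] -/
theorem rOp_smul (u : ℕ → L) (m : ℕ) (c : ℝ) (F : TruncSeries L n) : rOp u m (c • F) = c • rOp u m F := by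
  induction m generalizing F with
  | zero => rfl
  | succ m ih => rw [rOp_succ, rOp_succ, expOp_smul (Nat.succ_pos m), ih]

/-- `Q_m` is real-linear. [folklore] -/
theorem qOp_smul (u : ℕ → L) (m : ℕ) (c : ℝ) (F : TruncSeries L n) : qOp u m (c • F) = c • qOp u m F := by
  induction m generalizing F with
  | zero => rfl
  | succ m ih => rw [qOp_succ, qOp_succ, ih, expOp_smul (Nat.succ_pos m)]

/-- **The intertwining identity at the truncated level** ("`L_H R = R L_{QH}`"):
`H * R F = R (Q H * F)`. [cite: DeRoeckHuveneers2015, §3.3 eq. (3.15)] -/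
theorem mul_rOp (u : ℕ → L) (m : ℕ) (H F : TruncSeries L n) :
    H * rOp u m F = rOp u m (qOp u m H * F) := by
  rw [rOp_mul, rOp_qOp]

/-- Orders below `m + 1` are untouched by the factors added after stage `m`:
`(Q_{m'} F)_k = (Q_m F)_k` for `k ≤ m ≤ m'`. [cite: DeRoeckHuveneers2015, §3.3] -/
theorem qOp_coeff_stable (u : ℕ → L) {m m' : ℕ} (hmm' : m ≤ m') (F : TruncSeries L n) {k : ℕ}
    (hk : k ≤ m) (hkn : k ≤ n) : (qOp u m' F).coeff k = (qOp u m F).coeff k := by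
  induction m' with
  | zero =>
    have : m = 0 := Nat.le_zero.1 hmm'
    subst this; rfl
  | succ m' ih =>
    rcases Nat.lt_or_ge m (m' + 1) with h | h
    · rw [qOp_succ, expOp_coeff_of_lt (Nat.succ_pos m') _ _ (by omega) hkn, ih (by omega)]
    · have : m = m' + 1 := le_antisymm hmm' h
      subst this; rfl

/-! ### Evaluation at a real `ε` and the truncation remainder -/

/-- Evaluation `F ↦ ∑_{k ≤ n} ε^k F_k ∈ L`. [cite: DeRoeckHuveneers2015, §3.1 eq. (3.5)] -/
def eval (ε : ℝ) (F : TruncSeries L n) : L := ∑ k ∈ range (n + 1), ε ^ k • F.coeff k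

/-- Evaluation is additive. [folklore] -/
theorem eval_add (ε : ℝ) (F G : TruncSeries L n) : eval ε (F + G) = eval ε F + eval ε G := by
  simp [eval, sum_add_distrib, smul_add]

/-- Evaluation is real-linear. [folklore] -/
theorem eval_smul (ε c : ℝ) (F : TruncSeries L n) : eval ε (c • F) = c • eval ε F := by
  simp only [eval, coeff_smul, smul_sum]
  exact sum_congr rfl fun k _ => smul_comm _ _ _

/-- Evaluation of a negative. [folklore] -/
theorem eval_neg (ε : ℝ) (F : TruncSeries L n) : eval ε (-F) = -eval ε F := by
  simp [eval, smul_neg]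

/-- Evaluation of a difference. [folklore] -/
theorem eval_sub (ε : ℝ) (F G : TruncSeries L n) : eval ε (F - G) = eval ε F - eval ε G := by
  simp [eval, sum_sub_distrib, smul_sub]

/-- The bracket of the evaluations of two truncated series, as a double sum. [folklore] -/
theorem lie_eval_eval (ε : ℝ) (H F : TruncSeries L n) :
    ⁅eval ε H, eval ε F⁆ = ∑ i ∈ range (n + 1), ∑ j ∈ range (n + 1), ε ^ (i + j) • ⁅H.coeff i, F.coeff j⁆ := by
  unfold eval
  rw [sum_lie]
  refine sum_congr rfl fun i _ => ?_
  rw [lie_sum]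
  refine sum_congr rfl fun j _ => ?_
  rw [smul_lie, lie_smul, smul_smul, ← pow_add]

/-- Reindexing: antidiagonals `k ≤ n` versus the triangle `i + j ≤ n` of the square. [folklore] -/
theorem sum_range_antidiagonal_eq {M : Type*} [AddCommMonoid M] (g : ℕ × ℕ → M) (n : ℕ) :
    ∑ k ∈ range (n + 1), ∑ q ∈ antidiagonal k, g q =
      ∑ i ∈ range (n + 1), ∑ j ∈ range (n + 1), if i + j ≤ n then g (i, j) else 0 := by
  have hdisj : Set.PairwiseDisjoint (↑(range (n + 1)) : Set ℕ) (fun k => antidiagonal k) := by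
    intro k _ k' _ hkk'
    simp only [Function.onFun]
    rw [disjoint_left]
    intro q hq hq'
    rw [mem_antidiagonal] at hq hq'
    exact hkk' (hq.symm.trans hq')
  rw [← sum_biUnion hdisj]
  have hset : (range (n + 1)).biUnion (fun k => antidiagonal k) =
      ((range (n + 1)) ×ˢ (range (n + 1))).filter (fun q : ℕ × ℕ => q.1 + q.2 ≤ n) := by
    ext q
    simp only [mem_biUnion, mem_range, mem_antidiagonal, mem_filter, mem_product]
    constructor
    · rintro ⟨k, hk, hq⟩; omega
    · rintro ⟨⟨h1, h2⟩, h3⟩; exact ⟨q.1 + q.2, by omega, rfl⟩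
  rw [hset, sum_filter, sum_product]

/-- The evaluation of a truncated bracket, as a sum over `i + j ≤ n`. [folklore] -/
theorem eval_mul (ε : ℝ) (H F : TruncSeries L n) :
    eval ε (H * F) = ∑ i ∈ range (n + 1), ∑ j ∈ range (n + 1),
      if i + j ≤ n then ε ^ (i + j) • ⁅H.coeff i, F.coeff j⁆ else 0 := by
  unfold eval
  have h1 : ∑ k ∈ range (n + 1), ε ^ k • (H * F).coeff k =
      ∑ k ∈ range (n + 1), ∑ q ∈ antidiagonal k, ε ^ (q.1 + q.2) • ⁅H.coeff q.1, F.coeff q.2⁆ := by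
    refine sum_congr rfl fun k hk => ?_
    rw [coeff_mul_of_le _ _ (by rw [mem_range] at hk; omega), smul_sum]
    refine sum_congr rfl fun q hq => ?_
    rw [mem_antidiagonal] at hq; rw [hq]
  rw [h1, sum_range_antidiagonal_eq (fun q : ℕ × ℕ => ε ^ (q.1 + q.2) • ⁅H.coeff q.1, F.coeff q.2⁆) n]

/-- **Truncation remainder** (the term `ε^{n+1} L_V (Rf)^{(n)}` of Proposition 1 (2)): if
`H = H_0 + ε H_1` (all higher coefficients vanish) then
`⁅eval ε H, eval ε F⁆ = eval ε (H * F) + ε^{n+1} ⁅H_1, F_n⁆`. [cite: DeRoeckHuveneers2015, §3.3 proof of Prop. 1 (2)] -/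
theorem lie_eval_eval_of_coeff_eq_zero (ε : ℝ) (H F : TruncSeries L n) (hn : 1 ≤ n)
    (hH : ∀ k, 2 ≤ k → H.coeff k = 0) :
    ⁅eval ε H, eval ε F⁆ = eval ε (H * F) + ε ^ (n + 1) • ⁅H.coeff 1, F.coeff n⁆ := by
  rw [lie_eval_eval, eval_mul]
  -- only `i = 0, 1` contribute on both sides
  have h01 : ({0, 1} : Finset ℕ) ⊆ range (n + 1) := by
    intro j hj
    simp only [mem_insert, mem_singleton] at hj
    rw [mem_range]; omega
  have hvan : ∀ i ∈ range (n + 1), i ∉ ({0, 1} : Finset ℕ) → H.coeff i = 0 := by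
    intro i _ hi
    simp only [mem_insert, mem_singleton, not_or] at hi
    exact hH i (by omega)
  rw [← sum_subset h01 (fun i hi hi' => by simp [hvan i hi hi']),
    ← sum_subset h01 (fun i hi hi' => by simp [hvan i hi hi']), sum_pair zero_ne_one, sum_pair zero_ne_one]
  -- `i = 0`: all `j ≤ n` satisfy `0 + j ≤ n`
  have h0 : ∑ j ∈ range (n + 1), (if 0 + j ≤ n then ε ^ (0 + j) • ⁅H.coeff 0, F.coeff j⁆ else 0) =
      ∑ j ∈ range (n + 1), ε ^ (0 + j) • ⁅H.coeff 0, F.coeff j⁆ :=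
    sum_congr rfl fun j hj => if_pos (by rw [mem_range] at hj; omega)
  -- `i = 1`: the term `j = n` is missing
  have h1 : ∑ j ∈ range (n + 1), ε ^ (1 + j) • ⁅H.coeff 1, F.coeff j⁆ =
      ∑ j ∈ range (n + 1), (if 1 + j ≤ n then ε ^ (1 + j) • ⁅H.coeff 1, F.coeff j⁆ else 0) +
        ε ^ (n + 1) • ⁅H.coeff 1, F.coeff n⁆ := by
    rw [sum_range_succ, sum_range_succ, if_neg (by omega), add_zero, add_comm 1 n]
    congr 1
    exact sum_congr rfl fun j hj => (if_pos (by rw [mem_range] at hj; omega)).symm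
  rw [h0, h1]
  abel

end TruncSeries

end Literature.Algebra.Lie

end
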